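import Summits.AtomisticToContinuum.Crystallization.Theorems.OverbindingBudgetLocalHarmonicCertificate

/-!
# OverbindingBudget — the fine tolerance ladder RE-TYPED AFFINELY (decomp-a2c lens-4, generation 43, file A)

Draft node of decomp-a2c lens-4 g43 beneath the harmonic line of slot 3 (target of record, cone XLVI slot 3:
`TameBalancedDeepScaleGap (122/125) 0 4 (3/50) (1/450)`, «TBDSG»; g41 `…Theorems.OverbindingBudgetHarmonicNormalForm{Seam,}`,
g42 `…Theorems.OverbindingBudgetLocalHarmonicCertificate`).  It imports the g42 tree file and restates nothing.

## The finding that forces this file (memo NODE-g43 §1; cheapest falsifier of lens-4's own g41 ladder, run in g43).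
The Lennard-Jones hcp crystal is NOT an ideal close packing: its axial ratio relaxes.  With `V(r) = r⁻¹²/12 − r⁻⁶/6` the
absolutely convergent force/Hessian lattice sums at ideal hcp give `c/a = 1.632763 = √(8/3)·(1 − 1.408·10⁻⁴)` (cutoff-free to four
digits for `R_c ≥ 10`; relaxation gain `≈ 6·10⁻⁸` per site; `e_fcc − e_hcp ≈ 7.4·10⁻⁵`).  The two-shell `Framed ε` misfit of RELAXED hcp
against the ideal hcp pattern scaled by `nearestDist` is `1.135·10⁻⁴ · nn` (second shell; no isometry removes a non-similar strain).
Hence for every fine tolerance `ε₁ < 1.1·10⁻⁴` the sites of the (believed) LJ ground state are `(4, 3/50)`-deep but NOT `(ρ₁, ε₁)`-deep: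
they are MID sites, and `TameBalancedMidGap 4 ρ₁ ε₁ (3/50) (1/450)` must price `≈ N` of them against an excess `N·(e_hcp^relaxed − e⋆) +
O(N^{2/3})`, believed to be `O(N^{2/3})`.  So `MidAll ρ₁` (g41) is FALSE-IN-BELIEF for every `ρ₁` (true only if the periodic LJ ground-state
energy `e⋆` is NOT attained / approached by relaxed-hcp-like structures), and every cone consuming it at the `ε₁` delivered by B / B″
(XLVII, XLIX, L, XLIX-K) has a vacuous-in-belief slot: B″'s harmonic radius `ε₀ ≈ μ/(560 C ρ₁²)` is three orders below `1.1·10⁻⁴`, and at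
tolerances above it similarity charts cannot close the `O(κ³)` gap at the exact minimiser either (memo §1.3).  Nothing in the tree is
false (all landed statements are implications); the LINE needs its fine registration re-typed.  [own computation g43/numerics; the
distortion is acknowledged small but nonzero in [corpus: paper:arxiv-2012.05413 p.29]; rigid-hcp lattice sums [corpus: paper:arxiv-2107.14020 §4.5]]

## The repair: measure fine misfit MODULO HOMOGENEOUS STRAIN (this file).
`AffFramed ε θ g y i`: the 18-neighbourhood of `i` is matched within `ε·nn` by `y i + nn • A v`, `v` in the fcc/hcp two-shell pattern, for a
LINEAR map `A` that is `θ`-close to a linear isometry on the pattern (`‖A v − Q v‖ ≤ θ`).  `θ = 0` is `Framed ε` (§4); relaxed hcp, every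
homogeneously strained ideal stacking, is `AffFramed 0 θ` once `θ ≥` its strain.  The fine leaf, the MID census and the harmonic bridge are
re-typed over `AffDeepReg ρ ε θ g` (§1–§2, §5), and the TOLERANCE SEAM is re-proved verbatim (§3, `convexComb_core` of g41 by name):

    TBDSG  ⟸  TameBalancedAffDeepScaleGap (122/125) 0 ρ₁ ε₁ θ (1/450)  ∧  TameBalancedAffMidGap 4 ρ₁ ε₁ θ (3/50) (1/450)      (PROVED, §3)

* `TameBalancedAffDeepScaleGap` («F_aff», the affine fine leaf) — WEAKER than the target whenever `ε₁ + θ ≤ 3/50`, `ρ₁ ≥ 4` (§4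
  `fineAff_of_target`, PROVED: `AffFramed ε θ ⇒ Framed (ε + θ)`).
* `TameBalancedAffMidGap` / `AffMidAll ρ₁ θ` («MID_aff») — prices the sites that are `(4,3/50)`-deep but not AFFINELY `(ρ₁, ε₁, θ)`-deep:
  genuinely NON-AFFINELY distorted matter (strain gradients, defect far fields, internal relaxations of long polytypes), never a homogeneously
  strained crystal.  WEAKER than g41's MID at the same `(ρ₁, ε₁)` (§4 `affMid_of_mid`, PROVED) and — the point — no longer obstructed by the
  relaxed minimiser: the only zero-excess structure (relaxed hcp) is affinely exact; every non-affinely misfitted near-minimiser known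
  (hcp with sparse faults: misfit confined to `≈ 6` layers per fault, budget `γ_sf ≈ 1.5·10⁻⁴` per fault-area site; long polytypes with
  internal layer relaxation `u ≈ 2·10⁻⁵ a`, budget `≳ 10⁻⁵` per site) carries excess `≫ c(ε₁) ≍ λ ε₁²/ρ₁³` on its priced sites (memo §2).
  UNDECIDED · IDEA-NEEDED (as MID was), plausible-TRUE.
* `AffineChartStraightening` («R_aff», §5) — R with affine frames in and ONE common near-rigid linear map out; potential-free, ATTACKABLE-M.
* `HarmonicReductionAff R ρ₁ θ` («B_aff», §5) — `K_bent R → R_aff → ∃ ε₁ > 0, F_aff(ρ₁, ε₁, θ)`; WEAKER given its hypotheses (§5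
  `harmonicReductionAff_of_target`).  Its layer-3 split (localisation onto good matter; near/far regime split) is file B
  (`…Theorems.OverbindingBudgetAffineLocalisation`).
* CONE XLIX-A (§6, PROVED): `K_bent R → R_aff → B_aff R ρ₁ θ → AffMidAll ρ₁ θ → TBDSG`, and the nine-slot RDEF cone.

Why the affine chart is forced, not a convenience (memo §1.3): at the exact minimiser the census budget is exactly zero, so the zeroth-order
reference of the harmonic expansion must BE a periodic configuration of energy `≥ e⋆` with no Taylor error — an affine image of an ideal
stacking is one (its energy per particle is `≥ e⋆` by definition of `e⋆`, whatever the strain), a similarity image misses relaxed hcp by `κ`.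
K_bent needs no change: `BentChart`'s tolerance is RELATIVE (`η · dist`), so an affine chart `θ₀`-close to a similarity is an `η`-chart for
`η ≥ θ₀`; the near regime of file B works at `θ₀ ≈ 10⁻³ ≫ κ`.

Tags: F_aff WEAKER (proved) · MID_aff WEAKER-than-MID (proved), UNDECIDED·IDEA-NEEDED · R_aff TRUE-type·ATTACKABLE-M · B_aff WEAKER (proved
given K_bent, R_aff) · seams and cones PROVED, axioms standard.  No `sorry`.
-/

namespace Summit.AtomisticToContinuum.Crystallization.Theorems.OverbindingBudgetAffineLadder

open Filter Metric Set Topology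
open scoped BigOperators Classical
open Literature.MathematicalPhysics.StatisticalMechanics
open Literature.Geometry.DiscreteGeometry (IsChargeFree bondGraph nearestDist nearestDist_nonneg fccTwoShellPattern hcpTwoShellPattern)
open Summit.AtomisticToContinuum.Crystallization.Theses.OverbindingBudget (RobustDefectLimitWindows)
open Summit.AtomisticToContinuum.Crystallization.Theses.PricedLinkCensus (ChargedEnergyGap)
open Summit.AtomisticToContinuum.Crystallization.Theorems.OverbindingBudgetGradedBareness (CleanlessExcessT)
open Summit.AtomisticToContinuum.Crystallization.Theorems.OverbindingBudgetCoherentCut (CoherentResidual)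
open Summit.AtomisticToContinuum.Crystallization.Theorems.OverbindingBudgetTwoShellShape (TwoShellShape)
open Summit.AtomisticToContinuum.Crystallization.Theorems.OverbindingBudgetMisfitCensusStatements (Bad Short Long)
open Summit.AtomisticToContinuum.Crystallization.Theorems.OverbindingBudgetMisfitRegistration (Framed Reg DeepReg regScaleCount)
open Summit.AtomisticToContinuum.Crystallization.Theorems.OverbindingBudgetMisfitWindowStatements (InWindow offCount)
open Summit.AtomisticToContinuum.Crystallization.Theorems.OverbindingBudgetBalancedCensusStatements
open Summit.AtomisticToContinuum.Crystallization.Theorems.OverbindingBudgetBalancedCensusRecord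
open Summit.AtomisticToContinuum.Crystallization.Theorems.OverbindingBudgetHarmonicNormalForm
open Summit.AtomisticToContinuum.Crystallization.Theorems.OverbindingBudgetLocalHarmonicCertificate

variable {N : ℕ}

local notation "E3" => EuclideanSpace ℝ (Fin 3)

/-! ## §1  Affine registration predicates (potential-free, scale-free, local) -/

/-- `AffFramed ε θ g y i`: some AFFINE image of the fcc or the hcp two-shell pattern — linear part `A`, scale `nearestDist y i`, centre
`y i` — is matched injectively by sites within `ε · nearestDist y i`, every site `≠ y i` within `(3/2 + g) · nearestDist y i` is matched,
and `A` is `θ`-close to a linear isometry `Q` on the pattern: `‖A v − Q v‖ ≤ θ` for every pattern vector `v`.  (`θ = 0`: `Framed ε g`.) -/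
def AffFramed (ε θ g : ℝ) (y : Fin N → E3) (i : Fin N) : Prop :=
  ∃ (Q : E3 →ₗᵢ[ℝ] E3) (A : E3 →ₗ[ℝ] E3) (P : Finset E3) (f : E3 → E3),
    (P = fccTwoShellPattern ∨ P = hcpTwoShellPattern) ∧ (∀ v ∈ P, ‖A v - Q v‖ ≤ θ) ∧
    (∀ v ∈ P, f v ∈ Set.range y ∧ dist (f v) (y i + nearestDist y i • A v) ≤ ε * nearestDist y i) ∧ Set.InjOn f ↑P ∧
    ∀ k : Fin N, k ≠ i → dist (y k) (y i) ≤ (3 / 2 + g) * nearestDist y i → ∃ v ∈ P, f v = y k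

/-- `AffReg ε θ g y i`: `i` is `(1/100)`-charge-free and affinely two-shell framed. -/
def AffReg (ε θ g : ℝ) (y : Fin N → E3) (i : Fin N) : Prop :=
  IsChargeFree (1 / 100 : ℝ) y i ∧ AffFramed ε θ g y i

/-- `AffDeepReg ρ ε θ g y i`: every site within `ρ · nearestDist y i` of `y i` (including `i`) is affinely registered. -/
def AffDeepReg (ρ ε θ g : ℝ) (y : Fin N → E3) (i : Fin N) : Prop :=
  ∀ i' : Fin N, dist (y i') (y i) ≤ ρ * nearestDist y i → AffReg ε θ g y i'

/-- Number of scale-bad (SHORT/LONG) sites that are affinely `(ρ, ε, θ)`-deeply registered (the priced set of the affine fine leaf). -/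
noncomputable def affRegScaleCount (a s ρ ε θ g : ℝ) (y : Fin N → E3) : ℕ :=
  Nat.card {i : Fin N // (Bad a s y i ∧ (Short a s y i ∨ Long a s y i)) ∧ AffDeepReg ρ ε θ g y i}

/-- Number of sites that are NOT affinely `(ρ, ε, θ)`-deeply registered (the rebated set of the affine fine leaf). -/
noncomputable def notAffDeepCount (ρ ε θ g : ℝ) (y : Fin N → E3) : ℕ :=
  Nat.card {i : Fin N // ¬ AffDeepReg ρ ε θ g y i}

/-- Number of sites `(ρ, ε)`-deeply registered (similarity frames) but NOT affinely `(ρ₁, ε₁, θ)`-deeply registered («affine MID» sites: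
non-affinely distorted matter). -/
noncomputable def affMidCount (ρ ρ₁ ε₁ θ ε g : ℝ) (y : Fin N → E3) : ℕ :=
  Nat.card {i : Fin N // DeepReg ρ ε g y i ∧ ¬ AffDeepReg ρ₁ ε₁ θ g y i}

/-! ## §2  The affine fine leaf, the affine MID census, `AffMidAll` -/

/-- **`BalancedAffDeepScaleGapW a s ρ ε θ g σ₁ σ₂` («F_aff at one window»)** — `BalancedDeepScaleGapW` with the priced / rebated sets read
through AFFINE deep registration: `N e⋆ + c·#{aff-deep scale-bad} − C·#{not aff-deep} − C·#off − C·N^{2/3} − C·(gains) ≤ 𝓔(y)`. -/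
def BalancedAffDeepScaleGapW (a s ρ ε θ g σ₁ σ₂ : ℝ) : Prop :=
  ∃ c C : ℝ, 0 < c ∧ ∀ (N : ℕ) (y : Fin N → E3), Function.Injective y →
    ∃ u : E3, ‖u‖ = 1 ∧
      (N : ℝ) * (⨅ Q : PeriodicConfiguration 3, Q.energyPerParticle lennardJones) + c * (affRegScaleCount a s ρ ε θ g y : ℝ)
        - C * (notAffDeepCount ρ ε θ g y : ℝ) - C * (offCount σ₁ σ₂ y : ℝ) - C * (N : ℝ) ^ (2 / 3 : ℝ) - C * (dilGain y + shGain u y)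
        ≤ interactionEnergy lennardJones y

/-- **`TameBalancedAffDeepScaleGap a s ρ ε θ g` («F_aff»)** — the affine fine leaf at every window `[δ, 2]`, `0 < δ ≤ 2`. -/
def TameBalancedAffDeepScaleGap (a s ρ ε θ g : ℝ) : Prop :=
  ∀ δ : ℝ, 0 < δ → δ ≤ 2 → BalancedAffDeepScaleGapW a s ρ ε θ g δ 2

/-- **`BalancedAffMidGapW ρ ρ₁ ε₁ θ ε g σ₁ σ₂` («MID_aff at one window»)** — the affine-MID sites are priced in aggregate at `c > 0` each,
against the rebates of the leaf at `(ρ, ε)`. -/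
def BalancedAffMidGapW (ρ ρ₁ ε₁ θ ε g σ₁ σ₂ : ℝ) : Prop :=
  ∃ c C : ℝ, 0 < c ∧ ∀ (N : ℕ) (y : Fin N → E3), Function.Injective y →
    ∃ u : E3, ‖u‖ = 1 ∧
      (N : ℝ) * (⨅ Q : PeriodicConfiguration 3, Q.energyPerParticle lennardJones) + c * (affMidCount ρ ρ₁ ε₁ θ ε g y : ℝ)
        - C * (notDeepCount ρ ε g y : ℝ) - C * (offCount σ₁ σ₂ y : ℝ) - C * (N : ℝ) ^ (2 / 3 : ℝ) - C * (dilGain y + shGain u y)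
        ≤ interactionEnergy lennardJones y

/-- **`TameBalancedAffMidGap ρ ρ₁ ε₁ θ ε g` («MID_aff»)** — at every window `[δ, 2]`, `0 < δ ≤ 2`. -/
def TameBalancedAffMidGap (ρ ρ₁ ε₁ θ ε g : ℝ) : Prop :=
  ∀ δ : ℝ, 0 < δ → δ ≤ 2 → BalancedAffMidGapW ρ ρ₁ ε₁ θ ε g δ 2

/-- **`AffMidAll ρ₁ θ`** — MID_aff from affine `(ρ₁, ε₁, θ)` up to the registration frame of record `(4, 3/50)`, at EVERY fine residual
`ε₁ > 0` (constants may depend on `ε₁`; expected `c(ε₁) ≍ λ ε₁² / ρ₁³`).  UNDECIDED · IDEA-NEEDED; unlike `MidAll` it is not obstructed by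
the relaxed minimiser (module doc).  For `ε₁ ≥ 3/50` it is a pure depth census (packing + `floor_le`, routine). -/
def AffMidAll (ρ₁ θ : ℝ) : Prop :=
  ∀ ε₁ : ℝ, 0 < ε₁ → TameBalancedAffMidGap 4 ρ₁ ε₁ θ (3 / 50) (1 / 450)

/-! ## §3  THE AFFINE TOLERANCE SEAM (PROVED): F_aff ∧ MID_aff ⇒ leaf -/

/-- Counting: `#(scale-bad ∧ (ρ,ε)-deep) ≤ #(scale-bad ∧ aff-(ρ₁,ε₁,θ)-deep) + #MID_aff`. [this file] -/
theorem regScaleCount_le_affFine_add_affMid {a s ρ ρ₁ ε₁ θ ε g : ℝ} (y : Fin N → E3) :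
    regScaleCount a s ρ ε g y ≤ affRegScaleCount a s ρ₁ ε₁ θ g y + affMidCount ρ ρ₁ ε₁ θ ε g y := by
  simp only [regScaleCount, affRegScaleCount, affMidCount, Nat.card_eq_fintype_card, Fintype.card_subtype]
  calc (Finset.univ.filter fun i => (Bad a s y i ∧ (Short a s y i ∨ Long a s y i)) ∧ DeepReg ρ ε g y i).card
      ≤ ((Finset.univ.filter fun i => (Bad a s y i ∧ (Short a s y i ∨ Long a s y i)) ∧ AffDeepReg ρ₁ ε₁ θ g y i) ∪
          (Finset.univ.filter fun i => DeepReg ρ ε g y i ∧ ¬ AffDeepReg ρ₁ ε₁ θ g y i)).card := by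
        apply Finset.card_le_card
        intro i hi
        rw [Finset.mem_filter] at hi
        rw [Finset.mem_union, Finset.mem_filter, Finset.mem_filter]
        by_cases hD : AffDeepReg ρ₁ ε₁ θ g y i
        · exact Or.inl ⟨hi.1, hi.2.1, hD⟩
        · exact Or.inr ⟨hi.1, hi.2.2, hD⟩
    _ ≤ _ := Finset.card_union_le _ _

/-- Counting: `#¬aff-(ρ₁,ε₁,θ)-deep ≤ #¬(ρ,ε)-deep + #MID_aff`. [this file] -/
theorem notAffDeepCount_le_notDeep_add_affMid {ρ ρ₁ ε₁ θ ε g : ℝ} (y : Fin N → E3) :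
    notAffDeepCount ρ₁ ε₁ θ g y ≤ notDeepCount ρ ε g y + affMidCount ρ ρ₁ ε₁ θ ε g y := by
  simp only [notAffDeepCount, notDeepCount, affMidCount, Nat.card_eq_fintype_card, Fintype.card_subtype]
  calc (Finset.univ.filter fun i => ¬ AffDeepReg ρ₁ ε₁ θ g y i).card
      ≤ ((Finset.univ.filter fun i => ¬ DeepReg ρ ε g y i) ∪
          (Finset.univ.filter fun i => DeepReg ρ ε g y i ∧ ¬ AffDeepReg ρ₁ ε₁ θ g y i)).card := by
        apply Finset.card_le_card
        intro i hi
        rw [Finset.mem_filter] at hi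
        rw [Finset.mem_union, Finset.mem_filter, Finset.mem_filter]
        by_cases hD : DeepReg ρ ε g y i
        · exact Or.inr ⟨hi.1, hD, hi.2⟩
        · exact Or.inl ⟨hi.1, hD⟩
    _ ≤ _ := Finset.card_union_le _ _

/-- **THE AFFINE TOLERANCE SEAM at one window**: `F_aff(ρ₁,ε₁,θ) ∧ MID_aff(ρ → ρ₁,ε₁,θ) ⇒ BDSG_W(ρ, ε)`; constants exactly as in
g41's `balancedDeepScaleGapW_of_fine_mid` (its arithmetic core `convexComb_core` BY NAME). [this file] -/
theorem balancedDeepScaleGapW_of_affFine_affMid {a s ρ ρ₁ ε₁ θ ε g σ₁ σ₂ : ℝ}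
    (hF : BalancedAffDeepScaleGapW a s ρ₁ ε₁ θ g σ₁ σ₂) (hMid : BalancedAffMidGapW ρ ρ₁ ε₁ θ ε g σ₁ σ₂) :
    BalancedDeepScaleGapW a s ρ ε g σ₁ σ₂ := by
  obtain ⟨c₁, C₁, hc₁, h₁⟩ := hF
  obtain ⟨c₂, C₂, hc₂, h₂⟩ := hMid
  have hP₁0 : 0 ≤ max C₁ 0 := le_max_right _ _
  have hK : 0 < max C₁ 0 + c₂ + 1 := by linarith
  set t : ℝ := c₂ / (4 * (max C₁ 0 + c₂ + 1)) with ht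
  have ht0 : 0 < t := by rw [ht]; positivity
  have ht4 : t ≤ 1 / 4 := by
    rw [ht, div_le_iff₀ (by positivity)]
    nlinarith
  have htP : t * max C₁ 0 ≤ c₂ / 4 := by
    rw [ht, div_mul_eq_mul_div, div_le_iff₀ (by positivity)]
    nlinarith [mul_nonneg hc₂.le hP₁0, mul_nonneg hc₂.le hc₂.le]
  set m : ℝ := min (t * c₁) (c₂ / 4) with hm
  have hm0 : 0 < m := lt_min (mul_pos ht0 hc₁) (by positivity)
  refine ⟨m, max C₁ 0 + max C₂ 0, hm0, fun N y hy => ?_⟩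
  obtain ⟨u₁, hu₁, H₁⟩ := h₁ N y hy
  obtain ⟨u₂, hu₂, H₂⟩ := h₂ N y hy
  have hRc : (regScaleCount a s ρ ε g y : ℝ) ≤ affRegScaleCount a s ρ₁ ε₁ θ g y + affMidCount ρ ρ₁ ε₁ θ ε g y := by
    exact_mod_cast regScaleCount_le_affFine_add_affMid y
  have hDc : (notAffDeepCount ρ₁ ε₁ θ g y : ℝ) ≤ notDeepCount ρ ε g y + affMidCount ρ ρ₁ ε₁ θ ε g y := by
    exact_mod_cast notAffDeepCount_le_notDeep_add_affMid y
  have n1 : (0 : ℝ) ≤ affRegScaleCount a s ρ₁ ε₁ θ g y := Nat.cast_nonneg _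
  have n2 : (0 : ℝ) ≤ affMidCount ρ ρ₁ ε₁ θ ε g y := Nat.cast_nonneg _
  have n3 : (0 : ℝ) ≤ notDeepCount ρ ε g y := Nat.cast_nonneg _
  have n4 : (0 : ℝ) ≤ notAffDeepCount ρ₁ ε₁ θ g y := Nat.cast_nonneg _
  have n5 : (0 : ℝ) ≤ offCount σ₁ σ₂ y := Nat.cast_nonneg _
  have n6 : (0 : ℝ) ≤ (N : ℝ) ^ (2 / 3 : ℝ) := Real.rpow_nonneg (Nat.cast_nonneg _) _
  have g1 : 0 ≤ dilGain y + shGain u₁ y := add_nonneg (dilGain_nonneg y) (shGain_nonneg _ y)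
  have g2 : 0 ≤ dilGain y + shGain u₂ y := add_nonneg (dilGain_nonneg y) (shGain_nonneg _ y)
  rcases le_total (shGain u₁ y) (shGain u₂ y) with hle | hle
  · refine ⟨u₂, hu₂, ?_⟩
    exact convexComb_core H₁ H₂ hRc hDc n1 n2 n3 n4 n5 n6 g1 g2 (by linarith) le_rfl hc₂ ht0 ht4 htP hm0.le
      (min_le_left _ _) (min_le_right _ _)
  · refine ⟨u₁, hu₁, ?_⟩
    exact convexComb_core H₁ H₂ hRc hDc n1 n2 n3 n4 n5 n6 g1 g2 le_rfl (by linarith) hc₂ ht0 ht4 htP hm0.le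
      (min_le_left _ _) (min_le_right _ _)

/-- **THE AFFINE TOLERANCE SEAM (tame form).** `F_aff a s ρ₁ ε₁ θ g → MID_aff ρ ρ₁ ε₁ θ ε g → TameBalancedDeepScaleGap a s ρ ε g`. [this file] -/
theorem tameBalancedDeepScaleGap_of_affFine_affMid {a s ρ ρ₁ ε₁ θ ε g : ℝ} (hF : TameBalancedAffDeepScaleGap a s ρ₁ ε₁ θ g)
    (hMid : TameBalancedAffMidGap ρ ρ₁ ε₁ θ ε g) : TameBalancedDeepScaleGap a s ρ ε g :=
  fun δ hδ hδ2 => balancedDeepScaleGapW_of_affFine_affMid (hF δ hδ hδ2) (hMid δ hδ hδ2)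

/-- **Record seam.** `F_aff (122/125) 0 ρ₁ ε₁ θ (1/450) → MID_aff 4 ρ₁ ε₁ θ (3/50) (1/450) → TBDSG`. [this file] -/
theorem tbdsg_of_affFine_affMid_record (ε₁ ρ₁ θ : ℝ) (hF : TameBalancedAffDeepScaleGap (122 / 125) 0 ρ₁ ε₁ θ (1 / 450))
    (hM : TameBalancedAffMidGap 4 ρ₁ ε₁ θ (3 / 50) (1 / 450)) : TameBalancedDeepScaleGap (122 / 125) 0 4 (3 / 50) (1 / 450) :=
  tameBalancedDeepScaleGap_of_affFine_affMid hF hM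

/-! ## §4  Kernel arrows (PROVED): affine framing vs similarity framing; F_aff and MID_aff are on the WEAKER side -/

/-- A similarity frame is an affine frame with `θ`-defect zero: `Framed ε g ⇒ AffFramed ε θ g` for every `θ ≥ 0`. [this file] -/
theorem affFramed_of_framed {ε θ g : ℝ} (hθ : 0 ≤ θ) {y : Fin N → E3} {i : Fin N} (h : Framed ε g y i) : AffFramed ε θ g y i := by
  obtain ⟨A, P, f, hP, hf, hinj, hcov⟩ := h
  refine ⟨A, A.toLinearMap, P, f, hP, fun v _ => ?_, fun v hv => ?_, hinj, hcov⟩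
  · simpa using hθ
  · simpa using hf v hv

/-- An affine frame is a similarity frame at the coarser tolerance `ε + θ`: `AffFramed ε θ g ⇒ Framed (ε + θ) g`. [this file] -/
theorem framed_of_affFramed {ε θ g : ℝ} {y : Fin N → E3} {i : Fin N} (h : AffFramed ε θ g y i) : Framed (ε + θ) g y i := by
  obtain ⟨Q, A, P, f, hP, hAQ, hf, hinj, hcov⟩ := h
  refine ⟨Q, P, f, hP, fun v hv => ⟨(hf v hv).1, ?_⟩, hinj, hcov⟩
  have hnn : 0 ≤ nearestDist y i := nearestDist_nonneg y i
  have h1 := (hf v hv).2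
  have h2 : dist (y i + nearestDist y i • A v) (y i + nearestDist y i • Q v) ≤ θ * nearestDist y i := by
    rw [dist_eq_norm, add_sub_add_left_eq_sub, ← smul_sub, norm_smul, Real.norm_of_nonneg hnn, mul_comm]
    exact mul_le_mul_of_nonneg_right (hAQ v hv) hnn
  calc dist (f v) (y i + nearestDist y i • Q v)
      ≤ dist (f v) (y i + nearestDist y i • A v) + dist (y i + nearestDist y i • A v) (y i + nearestDist y i • Q v) :=
        dist_triangle _ _ _
    _ ≤ ε * nearestDist y i + θ * nearestDist y i := add_le_add h1 h2
    _ = (ε + θ) * nearestDist y i := by ring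

/-- `DeepReg ρ ε g ⇒ AffDeepReg ρ ε θ g` (`θ ≥ 0`). [this file] -/
theorem affDeepReg_of_deepReg {ρ ε θ g : ℝ} (hθ : 0 ≤ θ) {y : Fin N → E3} {i : Fin N} (h : DeepReg ρ ε g y i) :
    AffDeepReg ρ ε θ g y i :=
  fun i' hi' => ⟨(h i' hi').1, affFramed_of_framed hθ (h i' hi').2⟩

/-- `AffDeepReg ρ ε θ g ⇒ DeepReg ρ (ε + θ) g`. [this file] -/
theorem deepReg_of_affDeepReg {ρ ε θ g : ℝ} {y : Fin N → E3} {i : Fin N} (h : AffDeepReg ρ ε θ g y i) :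
    DeepReg ρ (ε + θ) g y i :=
  fun i' hi' => ⟨(h i' hi').1, framed_of_affFramed (h i' hi').2⟩

/-- Counting: `#(scale-bad ∧ aff-(ρ,ε,θ)-deep) ≤ #(scale-bad ∧ (ρ, ε+θ)-deep)`. [this file] -/
theorem affRegScaleCount_le_regScaleCount {a s ρ ε θ g : ℝ} (y : Fin N → E3) :
    affRegScaleCount a s ρ ε θ g y ≤ regScaleCount a s ρ (ε + θ) g y := by
  simp only [regScaleCount, affRegScaleCount, Nat.card_eq_fintype_card, Fintype.card_subtype]
  apply Finset.card_le_card
  intro i hi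
  rw [Finset.mem_filter] at hi ⊢
  exact ⟨hi.1, hi.2.1, deepReg_of_affDeepReg hi.2.2⟩

/-- Counting: `#¬(ρ, ε+θ)-deep ≤ #¬aff-(ρ,ε,θ)-deep`. [this file] -/
theorem notDeepCount_le_notAffDeepCount {ρ ε θ g : ℝ} (y : Fin N → E3) :
    notDeepCount ρ (ε + θ) g y ≤ notAffDeepCount ρ ε θ g y := by
  simp only [notDeepCount, notAffDeepCount, Nat.card_eq_fintype_card, Fintype.card_subtype]
  apply Finset.card_le_card
  intro i hi
  rw [Finset.mem_filter] at hi ⊢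
  exact ⟨hi.1, fun hD => hi.2 (deepReg_of_affDeepReg hD)⟩

/-- Counting: `#MID_aff(ρ₁,ε₁,θ) ≤ #MID(ρ₁,ε₁)` (`θ ≥ 0`). [this file] -/
theorem affMidCount_le_midCount {ρ ρ₁ ε₁ θ ε g : ℝ} (hθ : 0 ≤ θ) (y : Fin N → E3) :
    affMidCount ρ ρ₁ ε₁ θ ε g y ≤ midCount ρ ρ₁ ε₁ ε g y := by
  simp only [affMidCount, midCount, Nat.card_eq_fintype_card, Fintype.card_subtype]
  apply Finset.card_le_card
  intro i hi
  rw [Finset.mem_filter] at hi ⊢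
  exact ⟨hi.1, hi.2.1, fun hD => hi.2.2 (affDeepReg_of_deepReg hθ hD)⟩

/-- **F_aff is on the WEAKER side of the similarity fine leaf at tolerance `ε + θ`**: `BDSG_W(ρ, ε+θ) ⇒ F_aff,W(ρ, ε, θ)`
(prices a subset, rebates a superset). [this file] -/
theorem balancedAffDeepScaleGapW_of_bdsgW {a s ρ ε θ g σ₁ σ₂ : ℝ} (h : BalancedDeepScaleGapW a s ρ (ε + θ) g σ₁ σ₂) :
    BalancedAffDeepScaleGapW a s ρ ε θ g σ₁ σ₂ := by
  obtain ⟨c, C, hc, h⟩ := h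
  refine ⟨c, max C 0, hc, fun N y hy => ?_⟩
  obtain ⟨u, hu, e⟩ := h N y hy
  refine ⟨u, hu, ?_⟩
  have hC : C ≤ max C 0 := le_max_left _ _
  have hC0 : 0 ≤ max C 0 := le_max_right _ _
  have h1 : (0 : ℝ) ≤ notDeepCount ρ (ε + θ) g y := Nat.cast_nonneg _
  have h1' : (notDeepCount ρ (ε + θ) g y : ℝ) ≤ notAffDeepCount ρ ε θ g y := by exact_mod_cast notDeepCount_le_notAffDeepCount y
  have h0' : (affRegScaleCount a s ρ ε θ g y : ℝ) ≤ regScaleCount a s ρ (ε + θ) g y := by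
    exact_mod_cast affRegScaleCount_le_regScaleCount y
  have h2 : (0 : ℝ) ≤ offCount σ₁ σ₂ y := Nat.cast_nonneg _
  have h3 : (0 : ℝ) ≤ (N : ℝ) ^ (2 / 3 : ℝ) := Real.rpow_nonneg (Nat.cast_nonneg _) _
  have h4 : 0 ≤ dilGain y + shGain u y := add_nonneg (dilGain_nonneg y) (shGain_nonneg _ y)
  nlinarith [mul_le_mul_of_nonneg_right hC h1, mul_le_mul_of_nonneg_left h1' hC0, mul_le_mul_of_nonneg_left h0' hc.le,
    mul_le_mul_of_nonneg_right hC h2, mul_le_mul_of_nonneg_right hC h3, mul_le_mul_of_nonneg_right hC h4]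

/-- **The affine fine leaf is implied by the target of record** whenever `ε₁ + θ ≤ 3/50` and `ρ₁ ≥ 4`. [this file] -/
theorem fineAff_of_target {ε₁ θ ρ₁ : ℝ} (hε : ε₁ + θ ≤ 3 / 50) (hρ : 4 ≤ ρ₁)
    (h : TameBalancedDeepScaleGap (122 / 125) 0 4 (3 / 50) (1 / 450)) :
    TameBalancedAffDeepScaleGap (122 / 125) 0 ρ₁ ε₁ θ (1 / 450) :=
  fun δ hδ hδ2 => balancedAffDeepScaleGapW_of_bdsgW (fine_of_target hε hρ h δ hδ hδ2)

/-- **MID_aff is on the WEAKER side of g41's MID** at the same `(ρ₁, ε₁)` (`θ ≥ 0`: fewer priced sites, same rebates). [this file] -/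
theorem affMid_of_mid {ρ ρ₁ ε₁ θ ε g σ₁ σ₂ : ℝ} (hθ : 0 ≤ θ) (h : BalancedMidGapW ρ ρ₁ ε₁ ε g σ₁ σ₂) :
    BalancedAffMidGapW ρ ρ₁ ε₁ θ ε g σ₁ σ₂ := by
  obtain ⟨c, C, hc, h⟩ := h
  refine ⟨c, C, hc, fun N y hy => ?_⟩
  obtain ⟨u, hu, e⟩ := h N y hy
  refine ⟨u, hu, ?_⟩
  have h0 : (affMidCount ρ ρ₁ ε₁ θ ε g y : ℝ) ≤ midCount ρ ρ₁ ε₁ ε g y := by exact_mod_cast affMidCount_le_midCount hθ y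
  nlinarith [mul_le_mul_of_nonneg_left h0 hc.le]

/-- `MidAll ρ₁ ⇒ AffMidAll ρ₁ θ` is NOT claimed (AffMidAll also quantifies `ε₁ > 3/50`); at each `ε₁ ≤ 3/50` the tame forms compare:
`TameBalancedMidGap 4 ρ₁ ε₁ (3/50) g → TameBalancedAffMidGap 4 ρ₁ ε₁ θ (3/50) g`. [this file] -/
theorem tameAffMid_of_tameMid {ρ ρ₁ ε₁ θ ε g : ℝ} (hθ : 0 ≤ θ) (h : TameBalancedMidGap ρ ρ₁ ε₁ ε g) :
    TameBalancedAffMidGap ρ ρ₁ ε₁ θ ε g :=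
  fun δ hδ hδ2 => affMid_of_mid hθ (h δ hδ hδ2)

/-! ## §5  The affine harmonic attack: R_aff and B_aff -/

/-- **R_aff · `AffineChartStraightening`** (potential-free discrete rigidity; TRUE-type · ATTACKABLE-M).  There is `C ≥ 0` such that:
whenever `i` is affinely `(ρ, ε₁, θ)`-deeply registered (`ρ ≥ 4`, `θ ≤ 1/50`, `C ρ² ε₁ ≤ 1/100`), the configuration can be STRAIGHTENED —
moving every site by at most `C ρ² ε₁ · nn_i` — to a configuration `z` that is, on the `(ρ − 3)·nn_i`-ball, EXACTLY an affine image of a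
locally close-packed configuration: ONE scale `a₀` (`|a₀ − nn_i| ≤ C ε₁ nn_i`) and ONE linear map `B`, `(2θ + Cε₁)`-close to a linear
isometry in operator norm, such that every site there has the exact environment `z j + a₀ • B (A_j v)` (`A_j` a linear isometry, `v` in the
fcc or hcp two-shell pattern), covering every `z`-site within `3/2 · a₀`.  Mechanism as R (develop the frames outward; adjacent affine frames
share ≥ 4 non-coplanar matched points and agree to `O(ε₁)`; no holonomy on a ball; `ρ²` = drift); the common `B` is the ball-average of the
local linear parts.  R (similarity frames) is its `θ = 0` case up to constants. [FJM 2002; Schmidt 2009; Braun–Schmidt 2013 (shape)] -/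
def AffineChartStraightening : Prop :=
  ∃ C : ℝ, 0 ≤ C ∧ ∀ (ρ ε₁ θ : ℝ), 4 ≤ ρ → 0 < ε₁ → 0 ≤ θ → θ ≤ 1 / 50 → C * ρ ^ 2 * ε₁ ≤ 1 / 100 →
    ∀ (N : ℕ) (y : Fin N → E3) (i : Fin N), Function.Injective y → AffDeepReg ρ ε₁ θ (1 / 450) y i →
      ∃ (a₀ : ℝ) (B : E3 →ₗ[ℝ] E3) (Q₀ : E3 →ₗᵢ[ℝ] E3) (z : Fin N → E3),
        |a₀ - nearestDist y i| ≤ C * ε₁ * nearestDist y i ∧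
        (∀ v : E3, ‖B v - Q₀ v‖ ≤ (2 * θ + C * ε₁) * ‖v‖) ∧
        (∀ j, dist (z j) (y j) ≤ C * ρ ^ 2 * ε₁ * nearestDist y i) ∧
        ∀ j, dist (y j) (y i) ≤ (ρ - 3) * nearestDist y i →
          ∃ (A : E3 →ₗᵢ[ℝ] E3) (P : Finset E3), (P = fccTwoShellPattern ∨ P = hcpTwoShellPattern) ∧
            (∀ v ∈ P, ∃ k, z k = z j + a₀ • B (A v)) ∧
            ∀ k, k ≠ j → dist (z k) (z j) ≤ 3 / 2 * a₀ → ∃ v ∈ P, z k = z j + a₀ • B (A v)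

/-- **B_aff · `HarmonicReductionAff R ρ₁ θ`** (the affine bridge; its layer-3 split is file B).  `K_bent R → R_aff →
∃ ε₁ > 0, F_aff(122/125, 0, ρ₁, ε₁, θ, 1/450)`: bent-reference harmonic stability (g42, unchanged — its chart tolerance is relative, so an
affine chart `θ₀`-close to a similarity is an `η`-chart for `η ≥ θ₀`) and affine straightening give the affine fine leaf at SOME residual
`ε₁`.  Route (memo §3): localise onto GOOD matter (aff-fine-deep ∧ in-window; all pairs touching the rest cost `≤ C` per bad site by LJ
stability + packing); split good matter into the NEAR regime (affine chart `θ₀`-close to a similarity, not scale-bad; zero census budget;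
floor `e⋆` per site from the expansion about the site's OWN affine chart — zeroth order an affine image of an ideal stacking, `≥ e⋆` per
particle with NO Taylor error, first order boundary flux `O(ε₁)` per transition bond, second order by K_bent along the interpolation path,
tails variance-signed within the class) and the FAR regime (chart `≥ θ₀` from every similarity or scale-bad: true excess `≥ c_W θ₀²` per
site by Cauchy–Born coercivity, which pays its own crude `O(ε₁)` losses, the near side's transition and tail exchange `κ` per far site, and
the census price of the scale-bad sites).  Record literals: `θ = 1/25`, `θ₀ = 10⁻³ ≫ κ_hcp = 1.4·10⁻⁴`, `κ = 10⁻⁶`, `ε₁ ≲ 10⁻⁷`. -/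
def HarmonicReductionAff (R ρ₁ θ : ℝ) : Prop :=
  BentReferenceStability R → AffineChartStraightening →
    ∃ ε₁ : ℝ, 0 < ε₁ ∧ TameBalancedAffDeepScaleGap (122 / 125) 0 ρ₁ ε₁ θ (1 / 450)

/-- B_aff is on the WEAKER side: the target of record implies `HarmonicReductionAff R ρ₁ θ` for every `ρ₁ ≥ 4`, `0 ≤ θ < 3/50`
(witness `ε₁ = 3/50 − θ`). [this file] -/
theorem harmonicReductionAff_of_target (R : ℝ) {ρ₁ θ : ℝ} (hρ : 4 ≤ ρ₁) (hθ : θ < 3 / 50)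
    (h : TameBalancedDeepScaleGap (122 / 125) 0 4 (3 / 50) (1 / 450)) : HarmonicReductionAff R ρ₁ θ :=
  fun _ _ => ⟨3 / 50 - θ, by linarith, fineAff_of_target (by linarith) hρ h⟩

/-! ## §6  CONES (PROVED compositions) -/

/-- **CONE XLIX-A (slot 3 in affine harmonic normal form).** `K_bent R → R_aff → B_aff R ρ₁ θ → AffMidAll ρ₁ θ → TBDSG`. [this file] -/
theorem tbdsg_of_bentAff_midAllAff (R ρ₁ θ : ℝ) (hKb : BentReferenceStability R) (hR : AffineChartStraightening)
    (hB : HarmonicReductionAff R ρ₁ θ) (hM : AffMidAll ρ₁ θ) : TameBalancedDeepScaleGap (122 / 125) 0 4 (3 / 50) (1 / 450) := by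
  obtain ⟨ε₁, hε₁, hF⟩ := hB hKb hR
  exact tameBalancedDeepScaleGap_of_affFine_affMid hF (hM ε₁ hε₁)

/-- **RDEF CONE XLIX-A (record, nine slots)** — cone XLVI with slot 3 in affine harmonic normal form:
`ChargedEnergyGap → TwoShellShape (1/100) (3/50) (1/450) → K_bent R → R_aff → B_aff R ρ₁ θ → AffMidAll ρ₁ θ → CleanlessExcessT →
CoherentResidual 10 → RobustDefectLimitWindows`. [this file] -/
theorem rdef_of_ceg_shape_bentAff_midAllAff (R ρ₁ θ : ℝ) (hCEG : ChargedEnergyGap) (hT : TwoShellShape (1 / 100) (3 / 50) (1 / 450))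
    (hKb : BentReferenceStability R) (hR : AffineChartStraightening) (hB : HarmonicReductionAff R ρ₁ θ) (hM : AffMidAll ρ₁ θ)
    (hCE : CleanlessExcessT) (hRes : CoherentResidual 10) : RobustDefectLimitWindows :=
  rdef_of_ceg_shape_balancedDeep_record hCEG hT (tbdsg_of_bentAff_midAllAff R ρ₁ θ hKb hR hB hM) hCE hRes

end Summit.AtomisticToContinuum.Crystallization.Theorems.OverbindingBudgetAffineLadder
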